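import Literature.Probability.LatticeModels.Sweep1PassageProofs
import Literature.Probability.LatticeModels.RandomClusterBoxDuality
import Literature.Probability.LatticeModels.RandomClusterPinnedComparison
import HarnessLib

/-!
# Smirnov's a priori interface estimate: the free-arc half, and the full estimate given Yang's theorem

This file completes the proof architecture of the vendored fact
`fkInterface_passageProb_le` (Smirnov 2010, Appendix A, Lemma A.1: the probability that the FK
interface of a discrete Dobrushin domain at `p_c = √2/(1+√2)`, `q = 2` passes through an edge at
distance `≥ r` from one of the boundary arcs tends to zero with the mesh, uniformly in the
domain) by proving its **free-arc half** — the case "`e` is `r` away from the free arc `B`",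
which the printed proof dismisses with "treated similarly with clusters replaced by dual clusters,
which leads to the same result since the model is self-dual" — and gluing it to the wired-arc
half of `Sweep1PassageProofs`. The only remaining input is the tree's named fact
`spontaneousMagnetization_two_criticalBetaTwo` (Yang 1952: the critical planar Ising model has no
spontaneous magnetisation), exactly the last line of the printed proof:
`fkInterface_passageProb_le_of_yang`.

## The free-arc chain

For admissible data `E`, an edge `z` of `Ω_δ` all of whose endpoints are at sup-distance
`> m + 2` from the sites of the discrete arc `B`, and a configuration with `z ∈ γ`:

1. (`Sweep1Proofs.exists_dualReachable_of_mem_fkInterface`) `z` is a side of an inner face `f`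
   joined by dual-open edges of the completed configuration to a non-inner face.
2. (`exists_fence_exit`) **Fencing.** Before leaving the face box `f + Λ_m` this dual path only
   visits inner faces and only crosses `ω`-closed edges of `Ω_δ` off the arc `B`: a step from an
   inner to a non-inner face would cross a face-boundary edge, whose endpoints lie on
   `∂_{ℤ²} Ω_δ ⊆ A ∪ B`, hence (far from `B`) on the wired arc `A`, hence open. So the path reaches
   the ring `f + (Λ_{m+1} ∖ Λ_m)` by *fenced steps* (`fenceGraph`).
3. (`pinnedTransfer_mem_boxDualArm`) Transfer the domain configuration to the translated primal
   box `f + P_m`, `P_m = [-m, m+1]²` (faces `↔ Λ_m`), opening every box edge that is not an edge of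
   the interface graph (`RandomClusterPinnedComparison.pinnedTransfer`); fenced steps are open dual
   edges of the transferred configuration, so it lies in the decreasing event `boxDualArm m`
   ("the dual configuration joins the face `0` to the wired ring `∂Λ_{m+1}`").
4. (`mem_zdArcA_of_mem_pinnedEdges` + `rcMeasure_real_pinnedTransfer_le`) Far from `B`, every
   domain endpoint of a pinned box edge lies on the wired arc `A` (it is a site of `∂Ω_δ`), so the
   Holley/FKG comparison of `RandomClusterPinnedComparison` gives
   `φ^{A}_{Ω_δ}(transfer ∈ boxDualArm) ≤ φ⁰_{P_m,p_c,2}(boxDualArm)`.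
5. (`rcMeasure_pbox_real_boxDualArm`) By planar duality of the box
   (`RandomClusterBoxDuality.rcMeasure_pbox_real_eq_dual`, `p_c` self-dual) and Edwards–Sokal
   (`IsingPlusEdwardsSokal`), `φ⁰_{P_m,p_c,2}(boxDualArm) = φ¹_{Λ_{m+1},p_c,2}(0 ↔ ∂Λ_{m+1})`
   (`thetaWiredBox`), which tends to `0` by Yang's theorem
   (`thetaWiredBox_criticalFKIsing_tendsto_zero`).
6. A union bound over the (at most four) faces at a fixed endpoint of `z`
   (`real_mem_fkInterface_le_arcB`: `P(z ∈ γ) ≤ 4 φ¹_{Λ_{m+1}}(0 ↔ ∂Λ_{m+1})`), the choice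
   `m ≈ r/(4δ)` (`passageProb_le_of_infDist_arcB`), and the glue
   `Sweep1PassageProofs.fkInterface_passageProb_le_of_halves`.

## References

* [cite: Smirnov2010, Appendix A, Lemma A.1 and its proof; Rem. 4.9]
* [cite: Grimmett2006, §6.1, Thm. 6.13 (duality); Thm. (3.21) (Holley comparison)]
* [cite: Yang1952] via `spontaneousMagnetization_two_criticalBetaTwo` (hypothesis).
-/

noncomputable section

namespace Literature.Probability.LatticeModels

open MeasureTheory SimpleGraph Filter Finset
open _root_.Topology
open Literature.Barriers.CriticalPhenomena
open Literature.Probability.Percolation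


/-! ### Faces: corners, sides, neighbours and translations -/

section Faces

/-- The corners `sqCorner z k` are corners of the face `z`. [folklore] -/
theorem isCorner_sqCorner (z : Site 2) (k : Fin 4) : IsCorner (sqCorner z k) z := by
  intro i
  fin_cases k <;> fin_cases i <;> simp [sqCorner]

/-- The two corners of the `k`-th side of the face `z` are corners of the neighbouring face across
that side. [folklore] -/
theorem isCorner_sqCorner_sqNbr (z : Site 2) (k : Fin 4) :
    IsCorner (sqCorner z k) (sqNbr z k) ∧ IsCorner (sqCorner z (k + 1)) (sqNbr z k) := by
  constructor <;> intro i <;> fin_cases k <;> fin_cases i <;> simp [sqCorner, sqNbr]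

/-- A face is lattice-adjacent to its neighbouring faces. [folklore] -/
theorem zdGraph_adj_sqNbr (z : Site 2) (k : Fin 4) : (zdGraph 2).Adj z (sqNbr z k) := by
  have := dualEdge_mem_edgeSet_holds (sqSide_mem_edgeSet z k)
  rwa [dualEdge_sqSide, mem_edgeSet] at this

/-- Corners translate. [folklore] -/
theorem sqCorner_sub (z g : Site 2) (k : Fin 4) : sqCorner (z - g) k = sqCorner z k - g := by
  fin_cases k <;> simp [sqCorner] <;> abel

/-- Neighbouring faces translate. [folklore] -/
theorem sqNbr_sub (z g : Site 2) (k : Fin 4) : sqNbr (z - g) k = sqNbr z k - g := by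
  fin_cases k <;> simp [sqNbr] <;> abel

/-- Sides translate. [folklore] -/
theorem sqSide_sub (z g : Site 2) (k : Fin 4) : sqSide (z - g) k = (sqSide z k).map (· - g) := by
  rw [sqSide, sqSide, Sym2.map_mk, sqCorner_sub, sqCorner_sub]

/-- The faces having `x` as a corner: `x - c`, `c ∈ {0,1}²`. [folklore] -/
def cornerFaces (x : Site 2) : Finset (Site 2) :=
  {x, x - Pi.single 0 1, x - Pi.single 1 1, x - Pi.single 0 1 - Pi.single 1 1}

/-- A face of which `x` is a corner is one of the four `cornerFaces x`. [folklore] -/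
theorem mem_cornerFaces_of_isCorner {x f : Site 2} (h : IsCorner x f) : f ∈ cornerFaces x := by
  rw [cornerFaces]
  simp only [Finset.mem_insert, Finset.mem_singleton]
  have h0 := h 0
  have h1 := h 1
  rcases h0 with h0 | h0 <;> rcases h1 with h1 | h1
  · exact Or.inl (funext fun i => by fin_cases i <;> simp <;> omega)
  · exact Or.inr (Or.inr (Or.inl (funext fun i => by fin_cases i <;> simp <;> omega)))
  · exact Or.inr (Or.inl (funext fun i => by fin_cases i <;> simp <;> omega))
  · exact Or.inr (Or.inr (Or.inr (funext fun i => by fin_cases i <;> simp <;> omega)))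

/-- There are at most four faces at a corner. [folklore] -/
theorem card_cornerFaces_le (x : Site 2) : #(cornerFaces x) ≤ 4 := by
  rw [cornerFaces]
  refine (Finset.card_insert_le _ _).trans ?_
  refine (Nat.succ_le_succ (Finset.card_insert_le _ _)).trans ?_
  refine (Nat.succ_le_succ (Nat.succ_le_succ (Finset.card_insert_le _ _))).trans ?_
  rw [Finset.card_singleton]

/-- A face at the corner `x` is `x - c` with `c ∈ Λ_1 ∩ ℕ²`; in particular sup-distances from it
exceed those from `x` by at most one: if `b - f ∈ Λ_{n}` then `b - x ∈ Λ_{n+1}`. [folklore] -/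
theorem sub_mem_box_succ_of_mem_cornerFaces {x f b : Site 2} (hf : f ∈ cornerFaces x) {n : ℕ}
    (hb : b - f ∈ box 2 n) : b - x ∈ box 2 (n + 1) := by
  rw [cornerFaces] at hf
  simp only [Finset.mem_insert, Finset.mem_singleton] at hf
  rw [mem_box] at hb ⊢
  intro i
  have hbi := hb i
  rcases hf with rfl | rfl | rfl | rfl <;> fin_cases i <;> simp at hbi ⊢ <;> omega

/-- The primal box lies in `Λ_{m+1}`. [folklore] -/
theorem pbox_subset_box_succ (m : ℕ) : pbox m ⊆ box 2 (m + 1) := by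
  intro x hx
  rw [mem_pbox] at hx
  rw [mem_box]
  intro i
  have := hx i
  push_cast
  omega

end Faces

/-! ### The fence: dual steps of the interface's dual arm near an edge far from the free arc -/

section Fence

variable (E : DiscreteDobrushin) (ω : Percolation.BondConfig (Site 2)) (g : Site 2) (m : ℕ)

/-- One *fenced dual step* from the face `a` (with `a - g ∈ Λ_m`) to its `k`-th neighbour: across a
side of `a` which is an edge of `Ω_δ` without endpoint on the arc `B` and which is closed in `ω`.
[cite: Smirnov2010, Appendix A, proof of Lemma A.1] -/
def FenceRel (a b : Site 2) : Prop :=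
  a - g ∈ box 2 m ∧ ∃ k : Fin 4, b = sqNbr a k ∧ sqSide a k ∉ ω ∧
    sqSide a k ∈ (discreteDomainGraph E.Ω E.δ).edgeSet ∧ ∀ x ∈ sqSide a k, x ∉ E.zdArcB

/-- The graph of fenced dual steps. [cite: Smirnov2010, Appendix A, proof of Lemma A.1] -/
def fenceGraph : SimpleGraph (Site 2) := SimpleGraph.fromRel (FenceRel E ω g m)

variable {E ω g m}

/-- **First exit of the dual arm, fenced.** For admissible data, if no site of the arc `B` lies in
`g + Λ_{m+1}`, a dual-open path (w.r.t. the completed configuration `E.bcBondConfig ω`) from an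
inner face `a` with `a - g ∈ Λ_m` to a non-inner face passes, before it first leaves `g + Λ_m`,
only through inner faces and only across `ω`-closed edges of `Ω_δ` off the arc `B` (an inner face
is separated from a non-inner one by a face-boundary edge, whose endpoints are on `∂_{ℤ²}`, hence
on the arc `A`, hence wired open); so it reaches the ring `g + (Λ_{m+1} ∖ Λ_m)` by fenced steps.
[cite: Smirnov2010, Appendix A, proof of Lemma A.1] -/
theorem exists_fence_exit (hE : E.IsZdAdmissible) (hfarB : ∀ b ∈ E.zdArcB, b - g ∉ box 2 (m + 1))
    {a f₀ : Site 2} (p : (Percolation.openGraph (dualConfig (E.bcBondConfig ω))).Walk a f₀)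
    (ha : a - g ∈ box 2 m) (hin : E.IsInnerFace a) (hf₀ : ¬ E.IsInnerFace f₀) :
    ∃ t : Site 2, t - g ∈ box 2 (m + 1) ∧ t - g ∉ box 2 m ∧ (fenceGraph E ω g m).Reachable a t := by
  induction p with
  | nil => exact absurd hin hf₀
  | @cons a b _ hadj _ ih =>
    rw [Percolation.openGraph_adj, mem_dualConfig_iff] at hadj
    obtain ⟨⟨hlat, hdual⟩, hne⟩ := hadj
    rw [mem_edgeSet] at hlat
    obtain ⟨k, rfl⟩ := exists_sqNbr_eq_of_adj hlat
    -- the crossed side `e = sqSide a k`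
    have hclosed : sqSide a k ∉ E.bcBondConfig ω := fun h => hdual _ h (dualEdge_sqSide a k)
    have hcorner := isCorner_sqCorner a
    have hdom : (discreteDomainGraph E.Ω E.δ).Adj (sqCorner a k) (sqCorner a (k + 1)) :=
      hin _ _ (hcorner k) (hcorner (k + 1)) (by have := sqSide_mem_edgeSet a k; rwa [sqSide, mem_edgeSet] at this)
    have hnoB : ∀ x ∈ sqSide a k, x ∉ E.zdArcB := by
      intro x hx hxB
      refine hfarB x hxB (pbox_subset_box_succ m ?_)
      rw [sqSide, Sym2.mem_iff] at hx
      rcases hx with rfl | rfl <;> rw [← sqCorner_sub] <;> exact sqCorner_mem_pbox ha _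
    have hω : sqSide a k ∉ ω := by
      intro hωe
      refine hclosed ((DiscreteDobrushin.mem_bcBondConfig_iff _).2 ⟨?_, Or.inr ⟨hωe, hnoB⟩⟩)
      rw [sqSide, mem_edgeSet]; exact hdom
    -- the next face is inner: otherwise the side is a face-boundary edge with both ends on `A`
    have hbin : E.IsInnerFace (sqNbr a k) := by
      by_contra hb
      have hfb : E.IsFaceBoundaryEdge (sqCorner a k) (sqCorner a (k + 1)) :=
        ⟨hdom, ⟨a, hin, hcorner k, hcorner (k + 1)⟩,
          ⟨sqNbr a k, hb, (isCorner_sqCorner_sqNbr a k).1, (isCorner_sqCorner_sqNbr a k).2⟩⟩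
      have hbd := hfb.mem_zdBoundary
      have hA : ∀ x ∈ sqSide a k, x ∈ E.zdArcA := by
        intro x hx
        have hxbd : x ∈ E.zdBoundary := by
          rw [sqSide, Sym2.mem_iff] at hx
          rcases hx with rfl | rfl
          · exact hbd.1
          · exact hbd.2
        rcases hE.zdBoundary_subset hxbd with h | h
        · exact h
        · exact absurd h (hnoB x hx)
      refine hclosed ((DiscreteDobrushin.mem_bcBondConfig_iff _).2 ⟨?_, Or.inl hA⟩)
      rw [sqSide, mem_edgeSet]; exact hdom
    have hstep : (fenceGraph E ω g m).Adj a (sqNbr a k) := by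
      rw [fenceGraph, fromRel_adj]
      refine ⟨hne, Or.inl ⟨ha, k, rfl, hω, ?_, hnoB⟩⟩
      rw [sqSide, mem_edgeSet]; exact hdom
    have hbbox : sqNbr a k - g ∈ box 2 (m + 1) := by
      rw [← sqNbr_sub]; exact sqNbr_mem_box_succ ha k
    by_cases hb : sqNbr a k - g ∈ box 2 m
    · obtain ⟨t, ht, htm, hreach⟩ := ih hb hbin hf₀
      exact ⟨t, ht, htm, hstep.reachable.trans hreach⟩
    · exact ⟨sqNbr a k, hbbox, hb, hstep.reachable⟩

end Fence

/-! ### The dual-arm event of the primal box, and its duality -/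

section DualEvent

variable (m : ℕ)

/-- The open dual edges of a configuration `ξ` of the primal box `P_m` (as a set of edges of the
dual box `Λ_{m+1}`): the touching edges crossing a closed edge of `ξ`; for `ξ ⊆ E(P_m)` a finite
set this is `dualConf m ξ` (`dualOpenSet_coe`). [cite: Grimmett2006, §6.1, eq. (6.3)] -/
def dualOpenSet (ξ : Percolation.BondConfig (PBoxV m)) : Percolation.BondConfig (BoxV 2 (m + 1)) :=
  {d | d ∈ touchEdges 2 m ∧ ∃ e ∈ pboxEdges m, e ∉ Sym2.map Subtype.val '' ξ ∧ dualEdge e = σB m d}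

/-- **The dual-arm event of the primal box**: the dual configuration joins the central face `0` to
the wired ring `∂Λ_{m+1}`. Decreasing in `ξ`. [cite: Smirnov2010, Appendix A, proof of Lemma A.1] -/
def boxDualArm : Set (Percolation.BondConfig (PBoxV m)) :=
  {ξ | ∃ y ∈ boxBoundary 2 (m + 1),
    (Percolation.openGraph (dualOpenSet m ξ)).Reachable (boxOrigin 2 (m + 1)) y}

/-- The wired-ring arm event of the dual box. [cite: Grimmett2006, §6.1] -/
def ringArm : Set (Percolation.BondConfig (BoxV 2 (m + 1))) :=
  {η | ∃ y ∈ boxBoundary 2 (m + 1), (Percolation.openGraph η).Reachable (boxOrigin 2 (m + 1)) y}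

variable {m}

/-- Opening primal edges closes dual edges. [cite: Grimmett2006, §6.1] -/
theorem dualOpenSet_antitone : Antitone (dualOpenSet m) := by
  intro ξ ξ' hle d hd
  obtain ⟨hd, e, he, heξ, hde⟩ := hd
  exact ⟨hd, e, he, fun h => heξ (Set.image_mono hle h), hde⟩

/-- The dual-arm event is decreasing. [cite: Grimmett2006, §2.1] -/
theorem isLowerSet_boxDualArm : IsLowerSet (boxDualArm m) := by
  intro ξ ξ' hle hξ
  obtain ⟨y, hy, hreach⟩ := hξ
  exact ⟨y, hy, hreach.mono (Percolation.openGraph_mono (dualOpenSet_antitone hle))⟩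

/-- On finite configurations of the primal box the open dual edges are `dualConf`. [cite: Grimmett2006, §6.1, eq. (6.3)] -/
theorem dualOpenSet_coe (ξ : Finset (Sym2 (PBoxV m))) :
    dualOpenSet m (↑ξ : Percolation.BondConfig (PBoxV m)) = ↑(dualConf m ξ) := by
  ext d
  rw [dualOpenSet, Set.mem_setOf_eq, Finset.mem_coe, dualConf, Finset.mem_filter, mem_dualOf_iff]
  refine and_congr_right fun _ => exists_congr fun e => and_congr_right fun _ => ?_
  refine and_congr_left fun _ => not_congr ?_
  rw [Finset.mem_map, Set.mem_image]
  simp only [Finset.mem_coe, Function.Embedding.sym2Map_apply, Function.Embedding.coe_subtype]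

/-- Membership in the dual-arm event of a finite configuration is membership of its dual
configuration in the ring-arm event. [cite: Grimmett2006, §6.1] -/
theorem coe_mem_boxDualArm_iff (ξ : Finset (Sym2 (PBoxV m))) :
    (↑ξ : Percolation.BondConfig (PBoxV m)) ∈ boxDualArm m ↔
      (↑(dualConf m ξ) : Percolation.BondConfig (BoxV 2 (m + 1))) ∈ ringArm m := by
  rw [boxDualArm, Set.mem_setOf_eq, dualOpenSet_coe]
  rfl

/-- **The dual-arm probability of the free primal box at `p_c` is the wired one-arm probability.**
By planar duality of the box (`rcMeasure_pbox_real_eq_dual`, the critical FK–Ising parameter being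
self-dual) and the Edwards–Sokal identification of the ring-wired touching-edge measure
(`isingCorr_plus_box_eq_rcMeasure_real`, `thetaWiredBox_succ_eq_isingCorr_plus`):
`φ⁰_{P_m,p_c,2}(dual arm 0 ↔ ∂Λ_{m+1}) = φ¹_{Λ_{m+1},p_c,2}(0 ↔ ∂Λ_{m+1})`.
[cite: Smirnov2010, Appendix A, proof of Lemma A.1 ("the model is self-dual"); Grimmett2006, Thm. 6.13] -/
theorem rcMeasure_pbox_real_boxDualArm (m : ℕ) :
    (rcMeasure (pboxGraph m) criticalFKIsingParam 2 ∅).real (boxDualArm m) =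
      thetaWiredBox 2 criticalFKIsingParam 2 (m + 1) := by
  have hp := criticalFKIsingParam_mem_Icc
  rw [rcMeasure_pbox_real_eq_dual hp two_pos (S := ringArm m)
    (fun ξ _ => coe_mem_boxDualArm_iff ξ), rcDualParam_criticalFKIsingParam,
    criticalFKIsingParam_eq_fkIsingParam,
    thetaWiredBox_succ_eq_isingCorr_plus two_pos criticalBetaTwo_pos.le,
    isingCorr_plus_box_eq_rcMeasure_real two_pos criticalBetaTwo_pos.le]
  rfl

end DualEvent

/-! ### The common vertex type of the domain and a translated primal box -/

section Joint

variable (E : DiscreteDobrushin) [Fintype (meshDomain E.Ω E.δ)] (g : Site 2) (m : ℕ)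

/-- The sites of the discrete domain together with those of the translated primal box `g + P_m`.
[folklore] -/
def faceJoint : Finset (Site 2) :=
  (Finset.univ : Finset (meshDomain E.Ω E.δ)).map (Function.Embedding.subtype _) ∪
    (pbox m).map (addRightEmbedding g)

/-- The common vertex type. [folklore] -/
abbrev FJ : Type := ↥(faceJoint E g m)

/-- The domain inside the common vertex type. [folklore] -/
def jDomF : meshDomain E.Ω E.δ ↪ FJ E g m :=
  ⟨fun x => ⟨x.1, Finset.mem_union_left _ (Finset.mem_map_of_mem _ (Finset.mem_univ x))⟩,
    fun _ _ h => Subtype.ext (congrArg Subtype.val h :)⟩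

/-- The translated primal box inside the common vertex type. [folklore] -/
def jBoxF : PBoxV m ↪ FJ E g m :=
  ⟨fun u => ⟨u.1 + g, Finset.mem_union_right _ (Finset.mem_map.2 ⟨u.1, u.2, rfl⟩)⟩,
    fun _ _ h => Subtype.ext (add_right_cancel (congrArg Subtype.val h))⟩

/-- Lattice position of a domain vertex. [folklore] -/
@[simp] theorem jDomF_coe (x : meshDomain E.Ω E.δ) : (jDomF E g m x : Site 2) = x.1 := rfl

/-- Lattice position of a box vertex. [folklore] -/
@[simp] theorem jBoxF_coe (u : PBoxV m) : (jBoxF E g m u : Site 2) = u.1 + g := rfl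

variable {E g m}

/-- Lattice positions of a transported box edge. [folklore] -/
theorem map_val_map_jBoxF (ê : Sym2 (PBoxV m)) :
    Sym2.map Subtype.val (Sym2.map (jBoxF E g m) ê) = Sym2.map (fun u : PBoxV m => u.1 + g) ê := by
  rw [Sym2.map_map]; rfl

/-- Lattice positions of a transported domain edge. [folklore] -/
theorem map_val_map_jDomF (e : Sym2 (meshDomain E.Ω E.δ)) :
    Sym2.map Subtype.val (Sym2.map (jDomF E g m) e) = Sym2.map Subtype.val e := by
  rw [Sym2.map_map]; rfl

variable [DecidableRel E.interfaceGraph.Adj]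

/-- **Pinned edges touch the domain only on the wired arc.** If no site of the arc `B` lies in
`g + Λ_{m+1}`, every domain vertex which is an endpoint of an edge of the translated box `g + P_m`
that is not an edge of the interface graph lies on the arc `A`: either the edge is not an edge of
`Ω_δ` (then the vertex is in `∂Ω_δ ⊆ A ∪ B`), or it is but was deleted for touching `B`
(impossible far from `B`). [cite: Smirnov2010, Appendix A, proof of Lemma A.1] -/
theorem mem_zdArcA_of_mem_pinnedEdges (hE : E.IsZdAdmissible)
    (hfarB : ∀ b ∈ E.zdArcB, b - g ∉ box 2 (m + 1)) :
    ∀ e ∈ pinnedEdges (jDomF E g m) E.interfaceGraph (jBoxF E g m) (pboxGraph m),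
      ∀ x : meshDomain E.Ω E.δ, jDomF E g m x ∈ (jBoxF E g m).sym2Map e →
        x ∈ Subtype.val ⁻¹' E.zdArcA := by
  intro e he x hx
  rw [pinnedEdges, Finset.mem_filter] at he
  obtain ⟨heP, heF⟩ := he
  induction e using Sym2.ind with
  | h u v =>
    rw [mem_edgeFinset, mem_edgeSet] at heP
    have hlat : (zdGraph 2).Adj u.1 v.1 := heP
    rw [Function.Embedding.sym2Map_apply, Sym2.map_mk, Sym2.mem_iff] at hx
    rw [Function.Embedding.sym2Map_apply, Sym2.map_mk] at heF
    suffices key : ∀ u v : PBoxV m, (zdGraph 2).Adj u.1 v.1 →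
        s(jBoxF E g m u, jBoxF E g m v) ∉ E.interfaceGraph.edgeFinset.map (jDomF E g m).sym2Map →
        jDomF E g m x = jBoxF E g m u → x.1 ∈ E.zdArcA by
      rcases hx with h | h
      · exact key u v hlat heF h
      · exact key v u hlat.symm (by rwa [Sym2.eq_swap]) h
    intro u v huv hF hxu
    have hxpos : x.1 = u.1 + g := congrArg Subtype.val hxu
    have hadj : (zdGraph 2).Adj x.1 (v.1 + g) := by
      rw [hxpos, ← zdGraph_adj_sub_iff _ _ g, add_sub_cancel_right, add_sub_cancel_right]
      exact huv
    have hxB : x.1 ∉ E.zdArcB := fun hB => hfarB _ hB (by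
      rw [hxpos, add_sub_cancel_right]; exact pbox_subset_box_succ m u.2)
    have hwB : v.1 + g ∉ E.zdArcB := fun hB => hfarB _ hB (by
      rw [add_sub_cancel_right]; exact pbox_subset_box_succ m v.2)
    by_cases hd : (discreteDomainGraph E.Ω E.δ).Adj x.1 (v.1 + g)
    · have hwΩ : v.1 + g ∈ meshDomain E.Ω E.δ := (discreteDomainGraph_adj_iff.1 hd).2.2
      have hH : E.interfaceGraph.Adj x ⟨v.1 + g, hwΩ⟩ := by
        rw [DiscreteDobrushin.interfaceGraph, deleteEdges_adj]
        refine ⟨hd, ?_⟩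
        rintro ⟨z, hz, hzB⟩
        rcases Sym2.mem_iff.1 hz with rfl | rfl
        · exact hxB hzB
        · exact hwB hzB
      exfalso
      apply hF
      rw [Finset.mem_map]
      refine ⟨s(x, ⟨v.1 + g, hwΩ⟩), mem_edgeFinset.2 hH, ?_⟩
      rw [Function.Embedding.sym2Map_apply, Sym2.map_mk, hxu,
        show jDomF E g m ⟨v.1 + g, hwΩ⟩ = jBoxF E g m v from Subtype.ext rfl]
    · have hbd : x.1 ∈ meshBoundary E.Ω E.δ := ⟨x.2, v.1 + g, hadj, hd⟩
      rcases hE.meshBoundary_subset hbd with h | h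
      · exact h
      · exact absurd h hxB

/-- A closed edge of `Ω_δ` off the arc `B` stays closed in the transferred box configuration.
[cite: Smirnov2010, Appendix A, proof of Lemma A.1] -/
theorem notMem_image_pinnedTransfer {ω : Percolation.BondConfig (meshDomain E.Ω E.δ)} {x y : Site 2}
    (hdom : (discreteDomainGraph E.Ω E.δ).Adj x y) (hxB : x ∉ E.zdArcB) (hyB : y ∉ E.zdArcB)
    (hω : s(x, y) ∉ Sym2.map Subtype.val '' ω) :
    s(x - g, y - g) ∉ Sym2.map Subtype.val ''
      pinnedTransfer (jDomF E g m) E.interfaceGraph (jBoxF E g m) (pboxGraph m) ω := by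
  rintro ⟨ê, hê, hval⟩
  have hpos : Sym2.map Subtype.val (Sym2.map (jBoxF E g m) ê) = s(x, y) := by
    rw [map_val_map_jBoxF, show (fun u : PBoxV m => u.1 + g) = (· + g) ∘ Subtype.val from rfl,
      ← Sym2.map_map, hval, Sym2.map_mk, sub_add_cancel, sub_add_cancel]
  rw [pinnedTransfer, Set.mem_preimage] at hê
  rcases hê with ⟨⟨eM, heM, hjeq⟩, -⟩ | hEF
  · apply hω
    refine ⟨eM, heM, ?_⟩
    have h := congrArg (Sym2.map Subtype.val) hjeq
    rwa [hpos, map_val_map_jDomF] at h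
  · rw [Finset.mem_coe, Finset.mem_sdiff] at hEF
    apply hEF.2
    have hxΩ : x ∈ meshDomain E.Ω E.δ := (discreteDomainGraph_adj_iff.1 hdom).2.1
    have hyΩ : y ∈ meshDomain E.Ω E.δ := (discreteDomainGraph_adj_iff.1 hdom).2.2
    have hH : E.interfaceGraph.Adj ⟨x, hxΩ⟩ ⟨y, hyΩ⟩ := by
      rw [DiscreteDobrushin.interfaceGraph, deleteEdges_adj]
      refine ⟨hdom, ?_⟩
      rintro ⟨z, hz, hzB⟩
      rcases Sym2.mem_iff.1 hz with rfl | rfl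
      · exact hxB hzB
      · exact hyB hzB
    rw [Finset.mem_map]
    refine ⟨s(⟨x, hxΩ⟩, ⟨y, hyΩ⟩), mem_edgeFinset.2 hH, ?_⟩
    apply Sym2.map.injective Subtype.val_injective
    rw [Function.Embedding.sym2Map_apply, map_val_map_jDomF, hpos, Sym2.map_mk]

/-- A fenced dual step is an open dual edge of the transferred box configuration.
[cite: Smirnov2010, Appendix A, proof of Lemma A.1] -/
theorem fence_mem_dualOpenSet {ω : Percolation.BondConfig (meshDomain E.Ω E.δ)} {a b : Site 2}
    (hab : FenceRel E (Sym2.map Subtype.val '' ω) g m a b) (ha' : a - g ∈ box 2 (m + 1))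
    (hb' : b - g ∈ box 2 (m + 1)) :
    s((⟨a - g, ha'⟩ : BoxV 2 (m + 1)), ⟨b - g, hb'⟩) ∈
      dualOpenSet m (pinnedTransfer (jDomF E g m) E.interfaceGraph (jBoxF E g m) (pboxGraph m) ω) := by
  obtain ⟨ha, k, hbk, hωe, hdom, hnoB⟩ := hab
  subst hbk
  refine ⟨?_, sqSide (a - g) k, sqSide_mem_pboxEdges ha k, ?_, ?_⟩
  · refine Finset.mem_filter.2 ⟨?_, ⟨a - g, ha'⟩, Sym2.mem_mk_left _ _, ha⟩
    rw [mem_edgeFinset, mem_edgeSet]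
    change (zdGraph 2).Adj (a - g) (sqNbr a k - g)
    rw [zdGraph_adj_sub_iff]
    exact zdGraph_adj_sqNbr a k
  · rw [sqSide, sqCorner_sub, sqCorner_sub]
    rw [sqSide, mem_edgeSet] at hdom
    exact notMem_image_pinnedTransfer hdom (hnoB _ (Sym2.mem_mk_left _ _))
      (hnoB _ (Sym2.mem_mk_right _ _)) hωe
  · rw [dualEdge_sqSide, sqNbr_sub]
    rfl

/-- **Fenced dual paths are dual arms of the transferred configuration.** A path of fenced dual
steps from the face `g` to a face of the ring `g + (Λ_{m+1} ∖ Λ_m)` gives the dual-arm event of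
the transferred configuration of the translated box. [cite: Smirnov2010, Appendix A, proof of Lemma A.1] -/
theorem pinnedTransfer_mem_boxDualArm {ω : Percolation.BondConfig (meshDomain E.Ω E.δ)} {t : Site 2}
    (hreach : (fenceGraph E (Sym2.map Subtype.val '' ω) g m).Reachable g t)
    (ht : t - g ∈ box 2 (m + 1)) (htm : t - g ∉ box 2 m) :
    pinnedTransfer (jDomF E g m) E.interfaceGraph (jBoxF E g m) (pboxGraph m) ω ∈ boxDualArm m := by
  set ξ := pinnedTransfer (jDomF E g m) E.interfaceGraph (jBoxF E g m) (pboxGraph m) ω with hξ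
  -- transport a fenced walk into the dual box
  have key : ∀ {a t : Site 2} (p : (fenceGraph E (Sym2.map Subtype.val '' ω) g m).Walk a t)
      (ha : a - g ∈ box 2 (m + 1)) (ht : t - g ∈ box 2 (m + 1)),
      (Percolation.openGraph (dualOpenSet m ξ)).Reachable (⟨a - g, ha⟩ : BoxV 2 (m + 1)) ⟨t - g, ht⟩ := by
    intro a t p
    induction p with
    | nil => intro ha ht; exact Reachable.refl _
    | @cons a b c hadj p ih =>
      intro ha ht
      rw [fenceGraph, fromRel_adj] at hadj
      obtain ⟨hne, hrel⟩ := hadj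
      have hb : b - g ∈ box 2 (m + 1) := by
        rcases hrel with ⟨ha0, k, rfl, -⟩ | ⟨hb0, -⟩
        · rw [← sqNbr_sub]; exact sqNbr_mem_box_succ ha0 k
        · exact box_mono 2 (Nat.le_succ m) hb0
      refine Reachable.trans (Adj.reachable ?_) (ih hb ht)
      rw [Percolation.openGraph_adj]
      refine ⟨?_, fun h => hne (sub_left_injective (congrArg Subtype.val h))⟩
      rcases hrel with hrel | hrel
      · exact fence_mem_dualOpenSet hrel ha hb
      · rw [Sym2.eq_swap]; exact fence_mem_dualOpenSet hrel hb ha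
  obtain ⟨p⟩ := hreach
  have h0 : g - g ∈ box 2 (m + 1) := by rw [sub_self]; exact zero_mem_box 2 (m + 1)
  have hreach' := key p h0 ht
  have horig : (⟨g - g, h0⟩ : BoxV 2 (m + 1)) = boxOrigin 2 (m + 1) := Subtype.ext (sub_self g)
  rw [horig] at hreach'
  exact ⟨⟨t - g, ht⟩, (mem_boxBoundary_iff_notMem _).2 htm, hreach'⟩

end Joint

section Assembly

/-- The critical FK–Ising parameter is positive. [cite: Smirnov2010, §2.1] -/
theorem criticalFKIsingParam_pos : 0 < criticalFKIsingParam := by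
  rw [criticalFKIsingParam]; positivity


/-- **The dual-arm bound for one face.** [cite: Smirnov2010, Appendix A, proof of Lemma A.1] -/
theorem rcMeasure_real_transfer_boxDualArm_le {E : DiscreteDobrushin} (hE : E.IsZdAdmissible)
    [Fintype (meshDomain E.Ω E.δ)] [DecidableRel E.interfaceGraph.Adj] {g : Site 2} {m : ℕ}
    (hfarB : ∀ b ∈ E.zdArcB, b - g ∉ box 2 (m + 1)) :
    (rcMeasure E.interfaceGraph criticalFKIsingParam 2 (Subtype.val ⁻¹' E.zdArcA)).real
        {ω | pinnedTransfer (jDomF E g m) E.interfaceGraph (jBoxF E g m) (pboxGraph m) ω ∈ boxDualArm m} ≤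
      thetaWiredBox 2 criticalFKIsingParam 2 (m + 1) := by
  have hp : criticalFKIsingParam ∈ Set.Ioc (0 : ℝ) 1 :=
    ⟨criticalFKIsingParam_pos, criticalFKIsingParam_mem_Icc.2⟩
  rw [← rcMeasure_pbox_real_boxDualArm m]
  exact rcMeasure_real_pinnedTransfer_le hp (by norm_num)
    (mem_zdArcA_of_mem_pinnedEdges hE hfarB) isLowerSet_boxDualArm

/-- **The passage probability of an edge far from the free arc** is at most four dual-arm
probabilities, i.e. `4 φ¹_{Λ_{m+1},p_c,2}(0 ↔ ∂Λ_{m+1})`. [cite: Smirnov2010, Appendix A, proof of Lemma A.1] -/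
theorem real_mem_fkInterface_le_arcB {E : DiscreteDobrushin} (hE : E.IsZdAdmissible) {z : MedialVertex}
    {m : ℕ} (hB : ∀ v ∈ z, ∀ b ∈ E.zdArcB, b - v ∉ box 2 (m + 2)) :
    (fkDobrushinMeasure E).real {ω | z ∈ fkInterface E ω} ≤
      4 * thetaWiredBox 2 criticalFKIsingParam 2 (m + 1) := by
  classical
  letI : Fintype (meshDomain E.Ω E.δ) := (meshDomain_finite hE.isBounded hE.delta_pos).fintype
  induction z using Sym2.ind with
  | h x₀ y₀ =>
    have hnotAB : s(x₀, y₀) ∉ E.zdABEdges := by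
      intro h
      obtain ⟨-, -, b, hb, hbB⟩ := h
      exact hB b hb b hbB (by rw [sub_self]; exact zero_mem_box 2 _)
    set DM : Site 2 → Set (Percolation.BondConfig (meshDomain E.Ω E.δ)) := fun f =>
      {ω | pinnedTransfer (jDomF E f m) E.interfaceGraph (jBoxF E f m) (pboxGraph m) ω ∈ boxDualArm m}
    have hincl : {ω : Percolation.BondConfig (meshDomain E.Ω E.δ) |
        Sym2.map Subtype.val '' ω ∈ {ω' | s(x₀, y₀) ∈ fkInterface E ω'}} ⊆ ⋃ f ∈ cornerFaces x₀, DM f := by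
      intro ω hω
      obtain ⟨f, f₀, hcorner, hinner, hf₀, -, hreach⟩ := exists_dualReachable_of_mem_fkInterface hE hω
      have hin : E.IsInnerFace f := hinner.resolve_right hnotAB
      have hf : f ∈ cornerFaces x₀ := mem_cornerFaces_of_isCorner (hcorner x₀ (Sym2.mem_mk_left _ _))
      have hfarB : ∀ b ∈ E.zdArcB, b - f ∉ box 2 (m + 1) := fun b hb hbf =>
        hB x₀ (Sym2.mem_mk_left _ _) b hb (sub_mem_box_succ_of_mem_cornerFaces hf hbf)
      obtain ⟨p⟩ := hreach
      have h0 : f - f ∈ box 2 m := by rw [sub_self]; exact zero_mem_box 2 m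
      obtain ⟨t, ht, htm, hft⟩ := exists_fence_exit hE hfarB p h0 hin hf₀
      exact Set.mem_biUnion hf (pinnedTransfer_mem_boxDualArm hft ht htm)
    rw [fkDobrushinMeasure_real_eq E hE.isBounded hE.delta_pos]
    haveI := isProbabilityMeasure_rcMeasure E.interfaceGraph criticalFKIsingParam_mem_Icc two_pos
      (Subtype.val ⁻¹' E.zdArcA)
    have hθ0 : 0 ≤ thetaWiredBox 2 criticalFKIsingParam 2 (m + 1) := measureReal_nonneg
    refine (measureReal_mono hincl (measure_ne_top _ _)).trans ?_
    refine (measureReal_biUnion_finset_le _ _).trans ?_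
    refine (Finset.sum_le_sum fun f hf => rcMeasure_real_transfer_boxDualArm_le hE
      (fun b hb hbf => hB x₀ (Sym2.mem_mk_left _ _) b hb
        (sub_mem_box_succ_of_mem_cornerFaces hf hbf))).trans ?_
    rw [Finset.sum_const, nsmul_eq_mul]
    exact mul_le_mul_of_nonneg_right (by exact_mod_cast card_cornerFaces_le x₀) hθ0

/-- **The a priori estimate away from the free arc, conditional on the decay of the wired one-arm
probability.** [cite: Smirnov2010, Appendix A, Lemma A.1 (case of the free arc); Rem. 4.9] -/
theorem passageProb_le_of_infDist_arcB
    (hθ : Tendsto (fun n : ℕ => thetaWiredBox 2 criticalFKIsingParam 2 n) atTop (𝓝 0))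
    {r : ℝ} (hr : 0 < r) :
    ∃ ρ : ℝ → ℝ, Tendsto ρ (𝓝[>] (0 : ℝ)) (𝓝 0) ∧
      ∀ (E : DiscreteDobrushin), E.IsZdAdmissible → ∀ z : MedialVertex,
        z ∈ (discreteDomainGraph E.Ω E.δ).edgeSet →
        r ≤ Metric.infDist (medialPoint E.δ z) (meshPoint E.δ '' E.zdArcB) →
        (fkDobrushinMeasure E).real {ω | z ∈ fkInterface E ω} ≤ ρ E.δ := by
  classical
  set N : ℝ → ℕ := fun δ => ⌊r / (4 * δ)⌋₊ with hN
  refine ⟨fun δ => if δ < r / 10 then 4 * thetaWiredBox 2 criticalFKIsingParam 2 (N δ + 1) else 1,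
    ?_, ?_⟩
  · have h1 : Tendsto (fun δ : ℝ => r / (4 * δ)) (𝓝[>] (0 : ℝ)) atTop := by
      have : (fun δ : ℝ => r / (4 * δ)) = fun δ => (r / 4) * δ⁻¹ := by
        funext δ; rw [div_mul_eq_div_div, div_eq_mul_inv]
      rw [this]
      exact tendsto_inv_nhdsGT_zero.const_mul_atTop (by positivity)
    have h2 : Tendsto (fun δ : ℝ => N δ + 1) (𝓝[>] (0 : ℝ)) atTop :=
      tendsto_add_atTop_nat 1 |>.comp (tendsto_nat_floor_atTop.comp h1)
    have h3 : Tendsto (fun δ : ℝ => 4 * thetaWiredBox 2 criticalFKIsingParam 2 (N δ + 1))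
        (𝓝[>] (0 : ℝ)) (𝓝 0) := by
      simpa using (hθ.comp h2).const_mul 4
    refine h3.congr' ?_
    filter_upwards [Ioo_mem_nhdsGT (show (0 : ℝ) < r / 10 by positivity)] with δ hδ
    rw [if_pos hδ.2]
  · intro E hE z hz hdist
    have hδ0 : 0 < E.δ := hE.delta_pos
    show _ ≤ (if E.δ < r / 10 then 4 * thetaWiredBox 2 criticalFKIsingParam 2 (N E.δ + 1) else 1)
    by_cases hδ : E.δ < r / 10
    · rw [if_pos hδ]
      refine real_mem_fkInterface_le_arcB hE (m := N E.δ) fun v hv b hb hbox => ?_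
      have hzlat : z ∈ (zdGraph 2).edgeSet := by
        induction z using Sym2.ind with
        | h x y => exact meshGraph_le_zdGraph _ _ (discreteDomainGraph_le_meshGraph _ _ hz)
      have h1 : dist (meshPoint E.δ v) (medialPoint E.δ z) ≤ E.δ :=
        dist_meshPoint_medialPoint_le hδ0.le hzlat hv
      have h2 : dist (meshPoint E.δ b) (meshPoint E.δ v) ≤ 2 * E.δ * (N E.δ + 2 : ℕ) :=
        dist_meshPoint_le_of_sub_mem_box hδ0.le hbox
      have h3 : 2 * E.δ * (N E.δ) ≤ r / 2 := by
        have hfl : (N E.δ : ℝ) ≤ r / (4 * E.δ) := Nat.floor_le (by positivity)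
        calc 2 * E.δ * (N E.δ) ≤ 2 * E.δ * (r / (4 * E.δ)) := by gcongr
          _ = r / 2 := by field_simp; ring
      have h4 : Metric.infDist (medialPoint E.δ z) (meshPoint E.δ '' E.zdArcB) ≤
          dist (medialPoint E.δ z) (meshPoint E.δ b) :=
        Metric.infDist_le_dist_of_mem (Set.mem_image_of_mem _ hb)
      have h5 : dist (medialPoint E.δ z) (meshPoint E.δ b) ≤ E.δ + 2 * E.δ * (N E.δ + 2 : ℕ) := by
        calc dist (medialPoint E.δ z) (meshPoint E.δ b)
            ≤ dist (medialPoint E.δ z) (meshPoint E.δ v) + dist (meshPoint E.δ v) (meshPoint E.δ b) :=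
              dist_triangle _ _ _
          _ ≤ E.δ + 2 * E.δ * (N E.δ + 2 : ℕ) := by
              rw [_root_.dist_comm] at h1; rw [_root_.dist_comm] at h2; exact add_le_add h1 h2
      push_cast at h5
      nlinarith
    · rw [if_neg hδ]
      exact measureReal_le_one

/-- **The free-arc half of Smirnov's a priori estimate, conditional only on Yang's theorem.**
[cite: Smirnov2010, Appendix A, Lemma A.1 (case of the free arc); Rem. 4.9] -/
theorem fkInterface_passageProb_le_arcB_of_yang (hYang : spontaneousMagnetization_two_criticalBetaTwo) :
    ∀ r : ℝ, 0 < r → ∃ ρ : ℝ → ℝ, Tendsto ρ (𝓝[>] (0 : ℝ)) (𝓝 0) ∧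
      ∀ (D : RandomPlanarGeometry.JordanDomain) (E : DiscreteDobrushin), E.Ω = D.carrier → E.IsZdAdmissible →
        ∀ z : MedialVertex, z ∈ (discreteDomainGraph E.Ω E.δ).edgeSet →
          r ≤ Metric.infDist (medialPoint E.δ z) (meshPoint E.δ '' E.zdArcB) →
          (fkDobrushinMeasure E).real {ω | z ∈ fkInterface E ω} ≤ ρ E.δ := by
  intro r hr
  obtain ⟨ρ, hρ, h⟩ :=
    passageProb_le_of_infDist_arcB (thetaWiredBox_criticalFKIsing_tendsto_zero hYang) hr
  exact ⟨ρ, hρ, fun _ E _ hE z hz hdist => h E hE z hz hdist⟩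

/-- **Smirnov's a priori estimate `fkInterface_passageProb_le`, conditional only on Yang's theorem.**
[cite: Smirnov2010, Appendix A, Lemma A.1; Yang1952] -/
theorem fkInterface_passageProb_le_of_yang (hYang : spontaneousMagnetization_two_criticalBetaTwo) :
    fkInterface_passageProb_le :=
  fkInterface_passageProb_le_of_halves (fkInterface_passageProb_le_arcA_of_yang hYang)
    (fkInterface_passageProb_le_arcB_of_yang hYang)

end Assembly

end Literature.Probability.LatticeModels
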